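import Summits.ResolutionOfSingularities.ResolutionOfSingularities.Theorems.PurelyInseparableDim4E2OfCJSAssembly
import Summits.ResolutionOfSingularities.ResolutionOfSingularities.Theorems.PurelyInseparableDim4E2OfCJSStrictTransform
import HarnessLib

/-!
# F4-I(3,3) FROM COSSART–JANNSEN–SAITO THM 6.40 ALONE: `KeyTheorem640_char_localized_isolated → NoIsolatedTrap 3 3`
# (cell `res-dim4-pi`, the E2(3,3) transfer row CLOSED — every OURS row discharged by name)

[OURS · counted 0 · AI work weaker than expert review.]  Cell `res-dim4-pi` (D-0157 DOOR 2), seat `res-dim4-p-2`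
g2 (holder of the E2 transfer rows).  NOTHING here proves Cossart–Jannsen–Saito's Theorem 6.40 itself (it enters
as the NAMED FACT F-111 `KeyTheorem640_char_localized_isolated`, a hypothesis), `NoIsolatedTrap 3 3`
unconditionally, or resolution of singularities in dimension ≥ 4 / characteristic `p`.

THE CHAIN (all in the tree; p-ids = gate proposals): the transfer row `IsolatedConeTwoChainLocalizes` (p663256)
was cut into (M)(N)(E)(I)(X) (p663940) and (M) into (M-a)(M-b) (p665567), (M-b) proved modulo (M-c)
`StrictTransformBlowup` (res-dim4-p-7 g2, p667552).  Discharged: (N) `nearRow` (res-dim4-p-1 g2 p664524 + p666374)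
· (E) `directrixRow` (res-dim4-p-1 g2 ⊃ res-dim4-p-5 g2 / res-dim4-p-3 g2, p666993) · (I) `isolationRow`
(res-dim4-p-11 g2, p665211 + p666809) · (X) `settingRow` (p664844) · (M-a) `globalModel_of_coneTwoChain` (p665319)
· (M-b) `localizationRow_of_strictTransform` (res-dim4-p-7 g2, p667552, with p666741/p667117) · (M-c)
`strictTransformBlowup` (res-dim4-p-11 g2, on res-dim4-p-5 g2's p666342/p667059).  Hence, by name and sorry-free:

* `localizationRow : LocalizationRow`, `modelRow : ModelRow`,
  `isolatedConeTwoChainLocalizesAlgClosed : IsolatedConeTwoChainLocalizesAlgClosed`;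
* **`noIsolatedTrap_three_three_of_KeyTheorem640 : KeyTheorem640_char_localized_isolated → NoIsolatedTrap 3 3`** —
  F4-I(3,3) (no infinite ISOLATED cone-2 chain of point blow-ups of the purely inseparable frame
  `z³ + F(x₀,…,x₃)` in characteristic `3`) follows from CJS LNM 2270 Thm. 6.40 in its unit-wise localised isolated
  form, with NO remaining OURS hypothesis.

[DIM4 · CJS-ROW] consumed: F-111 `Literature.AlgebraicGeometry.CossartJannsenSaito2020.KeyTheorem640_char_localized_isolated`
only.  bears_on: LADDER-RESOLUTION:D157-DOOR2 (res-dim4-pi · F4-I(3,3) · CJS dictionary · E2 row closed).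
Supports stmt-ResolutionOfSingularities-16155 (helper).
-/

set_option linter.dupNamespace false -- mandated namespace of this single-conjunct summit

noncomputable section

open Literature.AlgebraicGeometry.CossartJannsenSaito2020

namespace Summit.ResolutionOfSingularities.ResolutionOfSingularities.Theorems.PIDim4

namespace E2OfCJS

/-- **Row (M-b) DISCHARGED**: the global model localises (res-dim4-p-7 g2's `localizationRow_of_strictTransform`
fed with res-dim4-p-11 g2's `strictTransformBlowup`). [OURS · row M-b of the E2 transfer row]
[cite: CossartJannsenSaito2020, p. 107, Def. 6.38 / 6.39] [cite: Kollar2007, 3.30.2] -/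
theorem localizationRow : LocalizationRow :=
  localizationRow_of_strictTransform strictTransformBlowup

/-- **Row (M) DISCHARGED**: every E2-violating frame chain over an algebraically closed field of characteristic
`3` has a local scheme model ((M-a) `globalModel_of_coneTwoChain` ∧ (M-b) `localizationRow`).
[OURS · row M of the E2 transfer row] [folklore] -/
theorem modelRow : ModelRow :=
  modelRow_of_localizationRow localizationRow

/-- **The E2 transfer row over algebraically closed fields DISCHARGED**: `IsolatedConeTwoChainLocalizesAlgClosed`
(p663940) holds — rows (M), (N), (E), (I), (X) by name. [OURS · E2 transfer row, algebraically closed form]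
[folklore] -/
theorem isolatedConeTwoChainLocalizesAlgClosed : IsolatedConeTwoChainLocalizesAlgClosed :=
  isolatedConeTwoChainLocalizesAlgClosed_of_localizationRow localizationRow

/-- **F4-I(3,3) FROM CJS THM. 6.40 ALONE.**  `NoIsolatedTrap 3 3` — there is no infinite isolated cone-2 chain
of point blow-ups of the purely inseparable frame `z³ + F` in characteristic `3` — follows from the named fact
`KeyTheorem640_char_localized_isolated` (Cossart–Jannsen–Saito, LNM 2270, Thm. 6.40: no infinite fundamental
sequence of permissible point blow-ups at an isolated point of the Hilbert–Samuel stratum of an excellent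
scheme of dimension ≤ 5 under the characteristic hypothesis, unit-wise localised form).  Every OURS row of the
dictionary is a theorem of the tree; the ONLY hypothesis left is the published theorem itself.
[OURS · conditional on a NAMED PUBLISHED FACT only] [cite: CossartJannsenSaito2020, Thm. 6.40] -/
theorem noIsolatedTrap_three_three_of_KeyTheorem640 (hK640 : KeyTheorem640_char_localized_isolated.{0}) :
    NoIsolatedTrap 3 3 :=
  noIsolatedTrap_three_three_of_CJS_of_localizationRow hK640 localizationRow

/-! ## Appendix (same session): the GENERAL-FIELD transfer row of p663256 DISCHARGED, and `NoWideTrap 3 3` -/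

/-- **THE E2 TRANSFER ROW `IsolatedConeTwoChainLocalizes` (p663256, any field of characteristic `3`) HOLDS.**
Given an E2-violating isolated frame chain over `K`, its isolated `Step0 3` chain goes up to the algebraic
closure `K̄` (res-dim4-p-14's `IsolatedChainBaseChange.exists_isolatedChain_map`); over `K̄` the per-field
endgame (`no_isolated_chain_of_no_coneTwo_chain`: order dichotomy, K2(3), cone stabilisation, FT(3,3)) turns it
into an isolated CONE-TWO chain, whose local scheme model (`isolatedConeTwoChainLocalizesAlgClosed`: rows (M),
(N), (E), (I), (X)) is the required unit-wise localised CJS data — the row's conclusion does not mention the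
chain. [OURS · E2 transfer row, general form] [folklore] -/
theorem isolatedConeTwoChainLocalizes : IsolatedConeTwoChainLocalizes := by
  intro K _ _ _ c hc
  letI : DecidableEq (AlgebraicClosure K) := Classical.decEq _
  have h1 : ∃ c' : ℕ → State (AlgebraicClosure K), ∀ k, IsIsolated 3 (c' k).F ∧ Step0 3 (c' k) (c' (k + 1)) :=
    IsolatedChainBaseChange.exists_isolatedChain_map (algebraMap K (AlgebraicClosure K))
      ⟨c, fun k => ⟨(hc k).1, (hc k).2.1⟩⟩
  have h2 : ∃ c' : ℕ → State (AlgebraicClosure K), ∀ k, IsIsolated 3 (c' k).F ∧ Step0 3 (c' k) (c' (k + 1)) ∧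
      Literature.AlgebraicGeometry.Resolution.Hauser2010.ordZero (c' k).F = (3 : ℕ∞) ∧ RidgeBudget.ebar (c' k).F = 2 := by
    by_contra h
    exact no_isolated_chain_of_no_coneTwo_chain (AlgebraicClosure K) h h1
  obtain ⟨c', hc'⟩ := h2
  exact isolatedConeTwoChainLocalizesAlgClosed (AlgebraicClosure K) c' hc'

/-- **`NoWideTrap 3 3` FROM CJS THM. 6.40 ALONE**: no infinite isolated chain on the wide floor of the purely
inseparable frame in characteristic `3`, from the named fact `KeyTheorem640_char_localized_isolated` (p663256's
`noWideTrap_three_of_CJS` with its transfer row now a theorem). [OURS · conditional on a NAMED PUBLISHED FACT only]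
[cite: CossartJannsenSaito2020, Thm. 6.40] -/
theorem noWideTrap_three_three_of_KeyTheorem640 (hK640 : KeyTheorem640_char_localized_isolated.{0}) :
    RidgeBudget.NoWideTrap 3 3 :=
  noWideTrap_three_of_CJS hK640 isolatedConeTwoChainLocalizes

/-- F4-I(3,3) from CJS Thm. 6.40 a SECOND way: through p663256's two-hypothesis assembly with the transfer row
discharged (agrees with `noIsolatedTrap_three_three_of_KeyTheorem640`). [OURS · conditional on a NAMED PUBLISHED
FACT only] [cite: CossartJannsenSaito2020, Thm. 6.40] -/
theorem noIsolatedTrap_three_three_of_KeyTheorem640' (hK640 : KeyTheorem640_char_localized_isolated.{0}) :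
    NoIsolatedTrap 3 3 :=
  noIsolatedTrap_three_three_of_CJS hK640 isolatedConeTwoChainLocalizes

end E2OfCJS

end Summit.ResolutionOfSingularities.ResolutionOfSingularities.Theorems.PIDim4

end
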